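import Mathlib
import HarnessLib
import Literature.MathematicalPhysics.StatisticalMechanics.LennardJonesClusters
import Summits.AtomisticToContinuum.Crystallization.Theorems.ContactSaturationLadderCrossTermFloor

/-!
# GrainPercolationDial / LoopTunnelDial — the CROSS CEILING (registered stub `stub_crossCeiling`, GS-free)

decomp-a2c lens-5, generation 12.  The stub `stub_crossCeiling : CrossCeiling` is the FIRST stub of all four registered
skeletons of the lineage (items stmt-AtomisticToContinuum-34129 `PercolatingCase`, 34130 `CellularCase` of route
GrainPercolationDial; 27293 `NetworkCase`, 27294 `PocketCase` of route LoopTunnelDial) — the FINITE-RANGE half of the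
lens-5 bridge «volume excess against surface deficit» (`absurd_of_floorOn` / `absurd_of_floorOnR`, proved in the nodes).

STATEMENT (verbatim defs `restrictTo`, `chunkEnergy`, `ballChunk`, `CrossCeiling` of the registered skeletons): there is
`σ₂ ≥ 0` such that in every finite `7/10`-separated configuration `y : Fin N → ℝ³`, for every particle `c` and radius `R ≥ 1`,
the ball chunk `S = {k : |y_k − y_c| ≤ R}` has at most `64 R³` particles and its CROSS interaction with the complement,
`W(S) − 𝓔(y|S) = Σ_{i ∈ S} Σ_{k ∉ S} V_LJ(|y_i − y_k|)`, is `≥ −σ₂ R²`.  NO ground-state hypothesis: separation only.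

PROOF.  (§1) Bookkeeping on the Literature double sums (`two_mul_interactionEnergy_eq_sum_sum`,
`sum_sum_map_eq_two_mul_interactionEnergy`, `sum_sum_eq_add_compl`, `Finset.map_orderEmbOfFin_univ`): the quantity in the stub IS
the cross double sum (`cross_identity`).  (§2) The cross double sum over a ball of radius `R ≥ 1` about ANY point `p` is
`≥ −D R²` (`cross_floor`): for `R ≥ 9` this is lens-1's unit-layer bookkeeping of `Theorems.ContactSaturationLadderCrossTermFloor`
(`site_tail`, `site_skin`, `layer_card`, `core_card`, `sum_inv_cube_le` — all stated there for an arbitrary separation `δ`) run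
at `δ = 1/2 ≤ 7/10`; for `1 ≤ R < 9` the crude skin bound per site times the packing count `(4R+1)³ ≤ 125 R³ ≤ 1125 R²`
suffices.  (§3) The cardinality half is the packing bound `card_le_of_separated_of_dist_le` (as in the node,
`ballChunk_card_le`).  All `[folklore]`.
-/

set_option linter.dupNamespace false

noncomputable section

namespace Summit.AtomisticToContinuum.Crystallization.Theorems.GrainPercolationDialCrossCeiling

open scoped Topology BigOperators Classical
open Filter
open Literature.MathematicalPhysics.StatisticalMechanics Literature.Geometry.DiscreteGeometry
open Summit.AtomisticToContinuum.Crystallization.Theorems.ContactSaturationLadderCrossTermFloor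
  (site_tail site_skin layer_card core_card sum_inv_cube_le)

/-! ## Vocabulary (verbatim from the registered skeletons of 34129 / 34130 / 27293 / 27294) -/

/-- Ambient space. -/
abbrev E3 : Type := EuclideanSpace ℝ (Fin 3)

/-- Restriction of a configuration to a particle set `S` (ordered enumeration). -/
def restrictTo {N : ℕ} (S : Finset (Fin N)) (y : Fin N → E3) : Fin S.card → E3 :=
  fun k => y (S.orderEmbOfFin rfl k)

/-- The CHUNK ENERGY `W(S) = 𝓔(y) − 𝓔(y ∖ S)` (= internal energy of `S` + cross interaction of `S` with the rest). -/
def chunkEnergy {N : ℕ} (y : Fin N → E3) (S : Finset (Fin N)) : ℝ :=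
  interactionEnergy lennardJones y - interactionEnergy lennardJones (restrictTo Sᶜ y)

/-- The BALL CHUNK of radius `R` around particle `c`. -/
def ballChunk {N : ℕ} (y : Fin N → E3) (c : Fin N) (R : ℝ) : Finset (Fin N) :=
  Finset.univ.filter fun k => dist (y k) (y c) ≤ R

/-- **Leaf `CrossCeiling`** [ATTACKABLE · GS-free · provable now · M; cardinality half PROVED as `ballChunk_card_le`]: in a 7/10-separated finite configuration, a ball chunk of
radius `R ≥ 1` has at most `64 R³` particles (packing) and its CROSS interaction with the rest,
`W(S) − 𝓔(y|S) = Σ_{i ∈ S, k ∉ S} V(|y_i − y_k|)`, is ≥ −σ₂ R² (only the attractive r⁻⁶ tails cross the sphere; dyadic shell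
sums as in `sum_inv_pow_six_le_of_le_five`). -/
def CrossCeiling : Prop :=
  ∃ σ₂ : ℝ, 0 ≤ σ₂ ∧ ∀ (N : ℕ) (y : Fin N → E3), (∀ a b : Fin N, a ≠ b → (7 : ℝ) / 10 ≤ dist (y a) (y b)) →
    ∀ (c : Fin N) (R : ℝ), 1 ≤ R →
      ((ballChunk y c R).card : ℝ) ≤ 64 * R ^ 3 ∧
        -σ₂ * R ^ 2 ≤ chunkEnergy y (ballChunk y c R) - interactionEnergy lennardJones (restrictTo (ballChunk y c R) y)

/-! ## §1 Bookkeeping: the stub's quantity is the cross double sum -/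

variable {N : ℕ}

/-- The cross double sum is symmetric in `S ↔ Sᶜ`. [folklore] -/
theorem cross_symm (y : Fin N → E3) (S : Finset (Fin N)) :
    ∑ i ∈ Sᶜ, ∑ k ∈ S, lennardJones (dist (y i) (y k)) = ∑ i ∈ S, ∑ k ∈ Sᶜ, lennardJones (dist (y i) (y k)) := by
  rw [Finset.sum_comm]
  exact Finset.sum_congr rfl fun i _ => Finset.sum_congr rfl fun k _ => by rw [dist_comm]

/-- Twice the energy of the sub-configuration `y|S` is the double sum over `S × S` (diagonal terms vanish, `V_LJ(0) = 0`). [folklore] -/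
theorem two_mul_interactionEnergy_restrictTo (y : Fin N → E3) (S : Finset (Fin N)) :
    2 * interactionEnergy lennardJones (restrictTo S y) = ∑ i ∈ S, ∑ k ∈ S, lennardJones (dist (y i) (y k)) := by
  have h := sum_sum_map_eq_two_mul_interactionEnergy lennardJones lennardJones_zero y (S.orderEmbOfFin rfl).toEmbedding
  rw [Finset.map_orderEmbOfFin_univ S rfl] at h
  have hcomp : (y ∘ ⇑(S.orderEmbOfFin rfl).toEmbedding) = restrictTo S y := rfl
  rw [hcomp] at h
  exact h.symm

/-- **Cross identity**: `W(S) − 𝓔(y|S) = Σ_{i ∈ S} Σ_{k ∉ S} V_LJ(|y_i − y_k|)`. [folklore] -/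
theorem cross_identity (y : Fin N → E3) (S : Finset (Fin N)) :
    chunkEnergy y S - interactionEnergy lennardJones (restrictTo S y) =
      ∑ i ∈ S, ∑ k ∈ Sᶜ, lennardJones (dist (y i) (y k)) := by
  have hall := two_mul_interactionEnergy_eq_sum_sum lennardJones lennardJones_zero y
  have hsplit := sum_sum_eq_add_compl (fun i k => lennardJones (dist (y i) (y k))) S
  have hS := two_mul_interactionEnergy_restrictTo y S
  have hSc := two_mul_interactionEnergy_restrictTo y Sᶜ
  have hsymm := cross_symm y S
  unfold chunkEnergy
  linarith

/-! ## §2 The cross floor over a ball about an arbitrary point (separation `7/10` only) -/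

/-- Separation ⇒ injectivity. -/
theorem injective_of_sep {y : Fin N → E3} (hsep : ∀ a b : Fin N, a ≠ b → (7 : ℝ) / 10 ≤ dist (y a) (y b)) :
    Function.Injective y := by
  intro a b h
  by_contra hab
  have := hsep a b hab
  rw [h, dist_self] at this
  norm_num at this

/-- **Cross floor** (GS-free): there is `D ≥ 0` such that for every `7/10`-separated `y : Fin N → ℝ³`, every point `p` and every
`R ≥ 1`, `−D R² ≤ Σ_{|y_i − p| ≤ R} Σ_{|y_k − p| > R} V_LJ(|y_i − y_k|)`.  For `R ≥ 9`: lens-1's unit-layer bookkeeping at `δ = 1/2`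
(core `|y_i − p| ≤ R/2` by `site_tail` at depth `R/2` and `core_card`; outer half by unit layers of depth `m`, `layer_card` × `site_tail`
at depth `m ≥ 1`, `site_skin` at depth `0`, `Σ (m+1)⁻³ ≤ 2`); for `1 ≤ R < 9`: `site_skin` per site × packing count. [folklore] -/
theorem cross_floor : ∃ D : ℝ, 0 ≤ D ∧ ∀ (N : ℕ) (y : Fin N → E3),
    (∀ a b : Fin N, a ≠ b → (7 : ℝ) / 10 ≤ dist (y a) (y b)) → ∀ (p : E3) (R : ℝ), 1 ≤ R →
      -(D * R ^ 2) ≤ ∑ i ∈ (Finset.univ.filter fun i : Fin N => dist (y i) p ≤ R),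
        ∑ k ∈ (Finset.univ.filter fun i : Fin N => dist (y i) p ≤ R)ᶜ, lennardJones (dist (y i) (y k)) := by
  set δ : ℝ := 1 / 2 with hδdef
  have hδ : 0 < δ := by rw [hδdef]; norm_num
  have hδ1 : δ ≤ 1 := by rw [hδdef]; norm_num
  set A : ℝ := (1 / 6) * (250 * δ⁻¹ ^ 3) with hA
  have hA0 : 0 < A := by rw [hA]; positivity
  set D₁ : ℝ := 64 * A * δ⁻¹ ^ 3 + 60 * δ⁻¹ ^ 3 * (A * δ⁻¹ ^ 3 + 2 * A) with hD₁
  set D₂ : ℝ := 1125 * (A * δ⁻¹ ^ 3) with hD₂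
  have hD₁0 : 0 ≤ D₁ := by rw [hD₁]; positivity
  have hD₂0 : 0 ≤ D₂ := by rw [hD₂]; positivity
  -- forget the let-values (numeral let-values confuse `linarith`'s atom parsing); keep the defining equations
  clear_value δ A D₁ D₂
  refine ⟨D₁ + D₂, add_nonneg hD₁0 hD₂0, ?_⟩
  intro N y hsep7 p R hR1
  have hR0 : 0 < R := by linarith
  have hsep : ∀ k l : Fin N, k ≠ l → δ ≤ dist (y k) (y l) := fun k l hkl => by
    have := hsep7 k l hkl
    rw [hδdef]; linarith
  have hyinj : Function.Injective y := injective_of_sep hsep7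
  set W := Finset.univ.filter (fun i : Fin N => dist (y i) p ≤ R) with hW
  set T := Wᶜ with hT
  have hmW : ∀ i : Fin N, i ∈ W ↔ dist (y i) p ≤ R := fun i => by rw [hW]; simp
  have hmT : ∀ k : Fin N, k ∈ T → R < dist (y k) p := fun k hk => by
    rw [hT, Finset.mem_compl, hmW] at hk
    exact not_le.1 hk
  have hTi : ∀ i ∈ W, ∀ k ∈ T, k ≠ i := fun i hi k hk h => by
    rw [hT, Finset.mem_compl] at hk
    exact hk (h ▸ hi)
  have hR2 : 0 ≤ R ^ 2 := by positivity
  by_cases hR9 : 9 ≤ R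
  · ------------------------------------------------------------------ LARGE radius: lens-1's bookkeeping at δ = 1/2
    suffices hmain : -(D₁ * R ^ 2) ≤ ∑ i ∈ W, ∑ k ∈ T, lennardJones (dist (y i) (y k)) by
      have : 0 ≤ D₂ * R ^ 2 := mul_nonneg hD₂0 hR2
      have hsum : (D₁ + D₂) * R ^ 2 = D₁ * R ^ 2 + D₂ * R ^ 2 := by ring
      linarith
    -- split the window into the core `|y_i − p| ≤ R/2` and the outer half
    rw [← Finset.sum_filter_add_sum_filter_not W (fun i : Fin N => dist (y i) p ≤ R / 2)]
    set K := W.filter (fun i : Fin N => dist (y i) p ≤ R / 2) with hK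
    set O := W.filter (fun i : Fin N => ¬ dist (y i) p ≤ R / 2) with hO
    ------------------------------------------------------------------ the core
    have hcore_site : ∀ i ∈ K, -(A * (R / 2)⁻¹ ^ 3) ≤ ∑ k ∈ T, lennardJones (dist (y i) (y k)) := by
      intro i hi
      have hi' : dist (y i) p ≤ R / 2 := (Finset.mem_filter.1 hi).2
      have h := site_tail y hδ hsep p R T hmT (r := R / 2) (by rw [hδdef]; linarith) (i := i) (by linarith)
      have hA' : (1 / 6) * (250 * δ⁻¹ ^ 3 * (R / 2)⁻¹ ^ 3) = A * (R / 2)⁻¹ ^ 3 := by rw [hA]; ring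
      linarith
    have hKcard : (K.card : ℝ) ≤ 8 * R ^ 3 * δ⁻¹ ^ 3 := by
      have hKW : K = Finset.univ.filter (fun i : Fin N => dist (y i) p ≤ R / 2) := by
        ext i
        rw [hK, Finset.mem_filter, hmW]
        simp only [Finset.mem_filter, Finset.mem_univ, true_and]
        constructor
        · exact fun h => h.2
        · exact fun h => ⟨by linarith, h⟩
      rw [hKW]
      have h := core_card y hyinj hδ hsep p (R := R / 2) (by linarith)
      have h1 : 2 * (R / 2) / δ + 1 ≤ 2 * R / δ := by
        rw [show 2 * (R / 2) / δ = R / δ by ring, show 2 * R / δ = 2 * (R / δ) by ring]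
        have : 1 ≤ R / δ := by rw [le_div_iff₀ hδ]; linarith
        linarith
      have h0 : 0 ≤ 2 * (R / 2) / δ + 1 := by positivity
      calc ((Finset.univ.filter fun i : Fin N => dist (y i) p ≤ R / 2).card : ℝ) ≤ (2 * (R / 2) / δ + 1) ^ 3 := h
        _ ≤ (2 * R / δ) ^ 3 := pow_le_pow_left₀ h0 h1 3
        _ = 8 * R ^ 3 * δ⁻¹ ^ 3 := by ring
    have hcore : -(64 * A * δ⁻¹ ^ 3) ≤ ∑ i ∈ K, ∑ k ∈ T, lennardJones (dist (y i) (y k)) := by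
      have h1 := Finset.sum_le_sum hcore_site
      rw [Finset.sum_const, nsmul_eq_mul] at h1
      have h2 : (R / 2)⁻¹ ^ 3 = 8 * R⁻¹ ^ 3 := by
        rw [inv_div, div_eq_mul_inv, mul_pow]
        norm_num
      have h3 : R ^ 3 * R⁻¹ ^ 3 = 1 := by rw [← mul_pow, mul_inv_cancel₀ hR0.ne', one_pow]
      have h4 : (K.card : ℝ) * (A * (R / 2)⁻¹ ^ 3) ≤ 64 * A * δ⁻¹ ^ 3 := by
        rw [h2]
        calc (K.card : ℝ) * (A * (8 * R⁻¹ ^ 3)) ≤ (8 * R ^ 3 * δ⁻¹ ^ 3) * (A * (8 * R⁻¹ ^ 3)) :=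
              mul_le_mul_of_nonneg_right hKcard (by positivity)
          _ = 64 * A * δ⁻¹ ^ 3 * (R ^ 3 * R⁻¹ ^ 3) := by ring
          _ = 64 * A * δ⁻¹ ^ 3 := by rw [h3, mul_one]
      have h5 : (K.card : ℝ) * -(A * (R / 2)⁻¹ ^ 3) = -((K.card : ℝ) * (A * (R / 2)⁻¹ ^ 3)) := by ring
      linarith
    ------------------------------------------------------------------ the outer half, by unit layers
    set dep : Fin N → ℕ := fun i => ⌊R - dist (y i) p⌋₊ with hdep
    set M' : ℕ := ⌊R / 2⌋₊ with hM'
    set w : ℕ → ℝ := fun m => if m = 0 then A * δ⁻¹ ^ 3 else A * (m : ℝ)⁻¹ ^ 3 with hw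
    have hmaps : ∀ i ∈ O, dep i ∈ Finset.range (M' + 1) := by
      intro i hi
      have hiO : ¬ dist (y i) p ≤ R / 2 := (Finset.mem_filter.1 hi).2
      rw [Finset.mem_range, Nat.lt_add_one_iff]
      apply Nat.floor_le_floor
      linarith [not_le.1 hiO]
    have hfiber : ∀ m ∈ Finset.range (M' + 1),
        -(48 * δ⁻¹ ^ 3 * (R + 1) ^ 2 * w m) ≤ ∑ i ∈ O.filter (fun i => dep i = m), ∑ k ∈ T, lennardJones (dist (y i) (y k)) := by
      intro m hm
      have hmM : m ≤ M' := Nat.lt_add_one_iff.1 (Finset.mem_range.1 hm)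
      have hmR : (m : ℝ) ≤ R / 2 := le_trans (Nat.cast_le.2 hmM) (Nat.floor_le (by linarith))
      have hsub : O.filter (fun i => dep i = m) ⊆
          Finset.univ.filter (fun i : Fin N => R - m - 1 < dist (y i) p ∧ dist (y i) p ≤ R - m) := by
        intro i hi
        rw [Finset.mem_filter] at hi
        obtain ⟨hiO, hmi⟩ := hi
        have hiW : dist (y i) p ≤ R := (hmW i).1 (Finset.mem_filter.1 hiO).1
        have ht0 : 0 ≤ R - dist (y i) p := by linarith
        have h1 : ((dep i : ℕ) : ℝ) ≤ R - dist (y i) p := Nat.floor_le ht0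
        have h2 : R - dist (y i) p < (dep i : ℝ) + 1 := Nat.lt_floor_add_one _
        rw [hmi] at h1 h2
        simp only [Finset.mem_filter, Finset.mem_univ, true_and]
        constructor <;> linarith
      have hsite : ∀ i ∈ O.filter (fun i => dep i = m), -w m ≤ ∑ k ∈ T, lennardJones (dist (y i) (y k)) := by
        intro i hi
        have hiL := hsub hi
        simp only [Finset.mem_filter, Finset.mem_univ, true_and] at hiL
        have hiW : i ∈ W := (Finset.mem_filter.1 (Finset.mem_filter.1 hi).1).1
        by_cases hm0 : m = 0
        · subst hm0
          have hw0 : w 0 = A * δ⁻¹ ^ 3 := by rw [hw]; simp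
          rw [hw0]
          have h := site_skin y hδ hsep T (i := i) (hTi i hiW)
          have e : (1 / 6) * (250 * δ⁻¹ ^ 6) = A * δ⁻¹ ^ 3 := by rw [hA]; ring
          linarith
        · have hm1 : (1 : ℝ) ≤ m := by exact_mod_cast Nat.one_le_iff_ne_zero.2 hm0
          have hwm : w m = A * (m : ℝ)⁻¹ ^ 3 := by rw [hw]; simp [hm0]
          rw [hwm]
          have h := site_tail y hδ hsep p R T hmT (r := (m : ℝ)) (hδ1.trans hm1) (i := i) hiL.2
          have e : (1 / 6) * (250 * δ⁻¹ ^ 3 * (m : ℝ)⁻¹ ^ 3) = A * (m : ℝ)⁻¹ ^ 3 := by rw [hA]; ring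
          linarith
      have hw0 : 0 ≤ w m := by
        rw [hw]
        simp only
        split_ifs <;> positivity
      have hLcard := layer_card y hδ hδ1 hsep p (ρ := R) (m := m) (by rw [hδdef]; linarith)
      have hFcard : ((O.filter (fun i => dep i = m)).card : ℝ) ≤ 48 * δ⁻¹ ^ 3 * (R + 1) ^ 2 :=
        le_trans (by exact_mod_cast Finset.card_le_card hsub) hLcard
      have h1 := Finset.sum_le_sum hsite
      rw [Finset.sum_const, nsmul_eq_mul] at h1
      have h2 : ((O.filter (fun i => dep i = m)).card : ℝ) * w m ≤ 48 * δ⁻¹ ^ 3 * (R + 1) ^ 2 * w m :=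
        mul_le_mul_of_nonneg_right hFcard hw0
      have h3 : ((O.filter (fun i => dep i = m)).card : ℝ) * -w m = -(((O.filter (fun i => dep i = m)).card : ℝ) * w m) := by
        ring
      linarith
    have hwsum : ∑ m ∈ Finset.range (M' + 1), w m ≤ A * δ⁻¹ ^ 3 + 2 * A := by
      rw [Finset.sum_range_succ']
      have h0 : w 0 = A * δ⁻¹ ^ 3 := by rw [hw]; simp
      have h1 : ∀ m ∈ Finset.range M', w (m + 1) = A * ((m : ℝ) + 1)⁻¹ ^ 3 := by
        intro m _
        rw [hw]
        simp only [Nat.add_one_ne_zero, if_false, Nat.cast_add, Nat.cast_one]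
      rw [h0, Finset.sum_congr rfl h1, ← Finset.mul_sum]
      have h2 := sum_inv_cube_le M'
      have h3 : A * ∑ m ∈ Finset.range M', ((m : ℝ) + 1)⁻¹ ^ 3 ≤ A * 2 := mul_le_mul_of_nonneg_left h2 hA0.le
      linarith
    have houter : -(48 * δ⁻¹ ^ 3 * (R + 1) ^ 2 * (A * δ⁻¹ ^ 3 + 2 * A)) ≤ ∑ i ∈ O, ∑ k ∈ T, lennardJones (dist (y i) (y k)) := by
      rw [← Finset.sum_fiberwise_of_maps_to hmaps (fun i => ∑ k ∈ T, lennardJones (dist (y i) (y k)))]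
      have h1 := Finset.sum_le_sum hfiber
      have h2 : ∑ m ∈ Finset.range (M' + 1), (-(48 * δ⁻¹ ^ 3 * (R + 1) ^ 2 * w m))
          = -(48 * δ⁻¹ ^ 3 * (R + 1) ^ 2) * ∑ m ∈ Finset.range (M' + 1), w m := by
        rw [Finset.mul_sum]
        exact Finset.sum_congr rfl fun m _ => by ring
      rw [h2] at h1
      have h3 : 0 ≤ 48 * δ⁻¹ ^ 3 * (R + 1) ^ 2 := by positivity
      have h4 := mul_le_mul_of_nonneg_left hwsum h3
      linarith
    ------------------------------------------------------------------ conclusion of the large case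
    have h48 : 48 * (R + 1) ^ 2 ≤ 60 * R ^ 2 := by
      nlinarith [mul_nonneg (by linarith : (0 : ℝ) ≤ R - 9) (by linarith : (0 : ℝ) ≤ R + 1)]
    have hB0 : 0 ≤ A * δ⁻¹ ^ 3 + 2 * A := by positivity
    have hδ3 : 0 ≤ δ⁻¹ ^ 3 := by positivity
    have hρ2 : 1 ≤ R ^ 2 := by nlinarith
    have e1 : 64 * A * δ⁻¹ ^ 3 ≤ 64 * A * δ⁻¹ ^ 3 * R ^ 2 := le_mul_of_one_le_right (by positivity) hρ2
    have e2 : 48 * δ⁻¹ ^ 3 * (R + 1) ^ 2 * (A * δ⁻¹ ^ 3 + 2 * A) ≤ 60 * δ⁻¹ ^ 3 * (A * δ⁻¹ ^ 3 + 2 * A) * R ^ 2 := by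
      calc 48 * δ⁻¹ ^ 3 * (R + 1) ^ 2 * (A * δ⁻¹ ^ 3 + 2 * A)
          = (δ⁻¹ ^ 3 * (A * δ⁻¹ ^ 3 + 2 * A)) * (48 * (R + 1) ^ 2) := by ring
        _ ≤ (δ⁻¹ ^ 3 * (A * δ⁻¹ ^ 3 + 2 * A)) * (60 * R ^ 2) := mul_le_mul_of_nonneg_left h48 (mul_nonneg hδ3 hB0)
        _ = 60 * δ⁻¹ ^ 3 * (A * δ⁻¹ ^ 3 + 2 * A) * R ^ 2 := by ring
    have hDρ : D₁ * R ^ 2 = 64 * A * δ⁻¹ ^ 3 * R ^ 2 + 60 * δ⁻¹ ^ 3 * (A * δ⁻¹ ^ 3 + 2 * A) * R ^ 2 := by rw [hD₁]; ring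
    calc -(D₁ * R ^ 2) = -(64 * A * δ⁻¹ ^ 3 * R ^ 2) + -(60 * δ⁻¹ ^ 3 * (A * δ⁻¹ ^ 3 + 2 * A) * R ^ 2) := by
          rw [hDρ]; ring
      _ ≤ -(64 * A * δ⁻¹ ^ 3) + -(48 * δ⁻¹ ^ 3 * (R + 1) ^ 2 * (A * δ⁻¹ ^ 3 + 2 * A)) :=
          add_le_add (neg_le_neg e1) (neg_le_neg e2)
      _ ≤ _ := add_le_add hcore houter
  · ------------------------------------------------------------------ SMALL radius 1 ≤ R < 9: skin bound × packing count
    have hR9' : R < 9 := not_le.1 hR9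
    have hsite : ∀ i ∈ W, -(A * δ⁻¹ ^ 3) ≤ ∑ k ∈ T, lennardJones (dist (y i) (y k)) := by
      intro i hi
      have h := site_skin y hδ hsep T (i := i) (hTi i hi)
      have e : (1 / 6) * (250 * δ⁻¹ ^ 6) = A * δ⁻¹ ^ 3 := by rw [hA]; ring
      linarith
    have hWcard : (W.card : ℝ) ≤ 125 * R ^ 3 := by
      have h := core_card y hyinj hδ hsep p (R := R) hR0.le
      have h1 : 2 * R / δ + 1 ≤ 5 * R := by
        rw [hδdef]
        have : 2 * R / (1 / 2 : ℝ) = 4 * R := by ring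
        rw [this]; linarith
      have h0 : 0 ≤ 2 * R / δ + 1 := by positivity
      calc (W.card : ℝ) ≤ (2 * R / δ + 1) ^ 3 := h
        _ ≤ (5 * R) ^ 3 := pow_le_pow_left₀ h0 h1 3
        _ = 125 * R ^ 3 := by ring
    have h1 := Finset.sum_le_sum hsite
    rw [Finset.sum_const, nsmul_eq_mul] at h1
    have hAδ : 0 ≤ A * δ⁻¹ ^ 3 := by positivity
    have h2 : (W.card : ℝ) * (A * δ⁻¹ ^ 3) ≤ 125 * R ^ 3 * (A * δ⁻¹ ^ 3) := mul_le_mul_of_nonneg_right hWcard hAδ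
    have h3 : R ^ 3 ≤ 9 * R ^ 2 := by nlinarith
    have h4 : 125 * R ^ 3 * (A * δ⁻¹ ^ 3) ≤ D₂ * R ^ 2 := by
      rw [hD₂]; linarith [mul_le_mul_of_nonneg_right h3 hAδ]
    have h5 : 0 ≤ D₁ * R ^ 2 := mul_nonneg hD₁0 hR2
    calc -((D₁ + D₂) * R ^ 2) = -(D₁ * R ^ 2) + -(D₂ * R ^ 2) := by ring
      _ ≤ 0 + -(125 * R ^ 3 * (A * δ⁻¹ ^ 3)) := add_le_add (by linarith) (neg_le_neg h4)
      _ ≤ -((W.card : ℝ) * (A * δ⁻¹ ^ 3)) := by linarith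
      _ = (W.card : ℝ) * -(A * δ⁻¹ ^ 3) := by ring
      _ ≤ _ := h1

/-! ## §3 The cardinality half and the registered stub -/

/-- The cardinality half of `CrossCeiling` (packing bound `card_le_of_separated_of_dist_le`): a ball chunk of radius `R ≥ 1` in a
`7/10`-separated configuration has at most `(20R/7 + 1)³ ≤ 64 R³` particles. [folklore] -/
theorem ballChunk_card_le {y : Fin N → E3} (hsep : ∀ a b : Fin N, a ≠ b → (7 : ℝ) / 10 ≤ dist (y a) (y b))
    (c : Fin N) {R : ℝ} (hR : 1 ≤ R) : ((ballChunk y c R).card : ℝ) ≤ 64 * R ^ 3 := by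
  have hy := injective_of_sep hsep
  have h := card_le_of_separated_of_dist_le ((ballChunk y c R).image y) (y c) (r := 7 / 10) (R := R) (by norm_num)
    (by linarith)
    (by
      intro p hp
      obtain ⟨k, hk, rfl⟩ := Finset.mem_image.1 hp
      exact (Finset.mem_filter.1 hk).2)
    (by
      intro p hp q hq hpq
      obtain ⟨k, -, rfl⟩ := Finset.mem_image.1 hp
      obtain ⟨l, -, rfl⟩ := Finset.mem_image.1 hq
      exact hsep k l fun h' => hpq (by rw [h']))
  rw [Finset.card_image_of_injective _ hy] at h
  simp only [finrank_euclideanSpace, Fintype.card_fin] at h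
  have hle : 2 * R / (7 / 10) + 1 ≤ 4 * R := by
    rw [div_eq_mul_inv]; norm_num; linarith
  have h0 : 0 ≤ 2 * R / (7 / 10) + 1 := by positivity
  have h3 : (2 * R / (7 / 10) + 1) ^ 3 ≤ (4 * R) ^ 3 := pow_le_pow_left₀ h0 hle 3
  nlinarith

/-- The cross floor in RAW form (no local vocabulary), for use by other files: in a `7/10`-separated finite configuration the cross
interaction of the `R`-ball chunk about ANY point `p` with its complement is `≥ −σ₂ R²` for `R ≥ 1`. [folklore] -/
theorem cross_interaction_floor : ∃ σ₂ : ℝ, 0 ≤ σ₂ ∧ ∀ (N : ℕ) (y : Fin N → EuclideanSpace ℝ (Fin 3)),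
    (∀ a b : Fin N, a ≠ b → (7 : ℝ) / 10 ≤ dist (y a) (y b)) → ∀ (p : EuclideanSpace ℝ (Fin 3)) (R : ℝ), 1 ≤ R →
      -σ₂ * R ^ 2 ≤ ∑ i ∈ (Finset.univ.filter fun i : Fin N => dist (y i) p ≤ R),
        ∑ k ∈ (Finset.univ.filter fun i : Fin N => dist (y i) p ≤ R)ᶜ,
          Literature.MathematicalPhysics.StatisticalMechanics.lennardJones (dist (y i) (y k)) := by
  obtain ⟨D, hD0, hD⟩ := cross_floor
  refine ⟨D, hD0, fun N y hsep p R hR => ?_⟩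
  have h := hD N y hsep p R hR
  linarith

/-- **`stub_crossCeiling`** (registered stub of the skeletons on stmt-AtomisticToContinuum-34129 / 34130 / 27293 / 27294, by name and
verbatim signature): the GS-free cross ceiling = packing count `ballChunk_card_le` + `cross_identity` + `cross_interaction_floor`
at the centre `p = y c`. [folklore] -/
theorem stub_crossCeiling : CrossCeiling := by
  obtain ⟨D, hD0, hD⟩ := cross_interaction_floor
  refine ⟨D, hD0, fun N y hsep c R hR => ⟨ballChunk_card_le hsep c hR, ?_⟩⟩
  rw [cross_identity]
  have h := hD N y hsep (y c) R hR
  have hW : ballChunk y c R = Finset.univ.filter (fun i : Fin N => dist (y i) (y c) ≤ R) := rfl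
  rw [hW]
  exact h

/-- Pin: the stub IS the registered proposition `CrossCeiling`. -/
example : CrossCeiling := stub_crossCeiling

end Summit.AtomisticToContinuum.Crystallization.Theorems.GrainPercolationDialCrossCeiling

end
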